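import Mathlib
import Literature.NumberTheory.LFunctions.Zhang2022.Section14U017
import Literature.NumberTheory.LFunctions.Zhang2022.Section14Prop141Twisted
import HarnessLib

/-!
# Zhang (2022) §14 u017 at general `β`: the twisted left side of (14.8) re-indexed by conductor —
# `lhs148W ≪ rhs1417OnW` on the closed conductor range, and (14.8)ᵂ from its two `r`-ranges

Topic `Literature/NumberTheory/LFunctions/Zhang2022` (Landau–Siegel audit tree; verdict-neutral).
Y. Zhang, *Discrete mean estimates and the Landau–Siegel zero*, arXiv:2211.02515v1 (2022)
[Zhang2022LandauSiegel], §14 p. 79 (tex L3950–L3963; "the general case is almost identical", p. 76) —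
**an unrefereed manuscript under adjudication**; nothing here asserts or denies its Theorems 1–2, and
nothing here is about Landau–Siegel zeros. ZHANG-L discharge lane (WP14, seat zl-w14-p2; wanted item
W-u017 of the general-`β` chain of leaf `Skeleton.Prop141`, owner zl-closer-5).

The conductor re-indexing u017 of the left side of (14.8) ("If `θ (mod Dk)` is induced by a primitive
character `θ* (mod r)` … substituting `Dk = hr` …", p. 79) never looks inside the `p`-sum, so it holds
verbatim with any weight `w(p)` inserted next to `χθ̄(p)` — in particular with the twist
`(pt₀)^β = Typed.Sec14.wt D β p` of the general-`β` objects `Typed.Sec14.lhs148W` / `rhs1417OnW`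
(`Section14Prop141Twisted`). This file PROVES:

* `lhs148W_le_rhs1417OnW_closed` — for every `B`, all large `D`, every `β : ℂ` (no size condition)
  and all `𝐤*, 𝐚*` under (14.1)–(14.2): `lhs148W χ β 𝐤* 𝐚* ≤ B · rhs1417OnW χ β 𝐤* [2, ⌊2DP₄⌋]`;
* `step14u017W_closed` — the same in the `∃ C, ForAllLarge (A → ∀ β …)` shape asked for (W-u017);
* `eq148W_of_legs_closed` — (14.8)ᵂ (`lhs148W ≪ P²D^{−c}` for `|β| < 5α`, the hypothesis `h148` of
  `Typed.Sec14.eq145W_of_parts`) from the two `r`-range estimates on the closed range, `1 < r < D³` and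
  `D³ ≤ r ≤ 2DP₄`, stated inline (W-leg1, W-leg2);

and the weight-generic one-term / one-conductor / one-`k` lemmas (`changeLevel_term_eq_w`,
`fiber_sum_le_w`, `term_k_le_w`) behind them — the `β = 0` file `Section14U017` supplies the sizes
(`2DP₄ < P`) and the `(k,r) ↦ (r, Dk/r)` re-indexing (`sum_divisors_reindex_le`). The conductor range is
CLOSED at `⌊2DP₄⌋` for the reason recorded there (the printed strict `r < 2DP₄` misses `r = Dk = 2DP₄`
when `2P₄ ∈ ℕ`). No new definition, no new claim; Proposition 14.1 is NOT asserted.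

## References

* Y. Zhang, arXiv:2211.02515v1 (2022), §14 (14.8) and u016–u017, p. 79; Prop. 14.1 p. 76.
  [cite: Zhang2022LandauSiegel, §14 (14.8) p.79]
* H. L. Montgomery, R. C. Vaughan, *Multiplicative Number Theory I*, CUP 2007, §9.1 (induced
  characters and conductors). [cite: MontgomeryVaughan2007, §9.1]
-/

noncomputable section

open Complex Real ComplexConjugate

namespace Literature.NumberTheory.LFunctions.Zhang2022.Typed.Sec14

open Skeleton

/-! ## One term, with a weight `w(p)` -/

/-- **`θ(l) = θ*(l)·[(l,h) = 1]`, `θ̄(p) = θ̄*(p)`, `Δ(l/(Dpk)) = Δ(l/(phr))`** for `θ` induced to the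
modulus `Dk = hr` by `θ* (mod r)`, `p ∼ P` prime to `Dk`, with an arbitrary weight `w(p)` next to
`χθ̄(p)` (the twist `(pt₀)^β` in the application): the `l`-th terms of the two inner series agree.
[cite: Zhang2022LandauSiegel, §14 u017 p.79, tex L3956] -/
theorem changeLevel_term_eq_w {D : ℕ} [NeZero D] (χ : DirichletCharacter ℂ D) (w : ℕ → ℂ)
    {k r h : ℕ} (hhr : h * r = D * k) (hr : r ∣ D * k) (θ : DirichletCharacter ℂ r) (κs : ℕ → ℂ)
    (d l : ℕ)
    (hcop : ∀ p ∈ primeWindow D, Nat.Coprime p (D * k)) :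
    κs (d * l) * DirichletCharacter.changeLevel hr θ (l : ZMod (D * k)) *
        ∑ p ∈ primeWindow D, χ (p : ZMod D) *
          (DirichletCharacter.changeLevel hr θ)⁻¹ (p : ZMod (D * k)) * w p *
            DeltaW D ((l : ℝ) / ((D : ℝ) * p * k)) =
      if Nat.Coprime l h then κs (d * l) * θ (l : ZMod r) *
        ∑ p ∈ primeWindow D, χ (p : ZMod D) * θ⁻¹ (p : ZMod r) * w p *
          DeltaW D ((l : ℝ) / ((p : ℝ) * h * r)) else 0 := by
  -- the `p`-sums agree
  have hp_eq : ∑ p ∈ primeWindow D, χ (p : ZMod D) *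
          (DirichletCharacter.changeLevel hr θ)⁻¹ (p : ZMod (D * k)) * w p *
            DeltaW D ((l : ℝ) / ((D : ℝ) * p * k)) =
        ∑ p ∈ primeWindow D, χ (p : ZMod D) * θ⁻¹ (p : ZMod r) * w p *
          DeltaW D ((l : ℝ) / ((p : ℝ) * h * r)) := by
    refine Finset.sum_congr rfl fun p hp => ?_
    have hc : IsCoprime (p : ℤ) ((D * k : ℕ) : ℤ) := Nat.isCoprime_iff_coprime.mpr (hcop p hp)
    have e1 := DirichletCharacter.changeLevel_eq_cast_of_dvd' θ⁻¹ hr hc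
    push_cast at e1
    rw [← map_inv (DirichletCharacter.changeLevel hr) θ, e1]
    have harg : ((D : ℝ) * p * k) = (p : ℝ) * h * r := by
      have h' : ((h : ℝ) * r) = (D : ℝ) * k := by exact_mod_cast hhr
      calc (D : ℝ) * p * k = p * ((D : ℝ) * k) := by ring
        _ = p * ((h : ℝ) * r) := by rw [h']
        _ = (p : ℝ) * h * r := by ring
    rw [harg]
  rw [hp_eq]
  by_cases hl : Nat.Coprime l (D * k)
  · -- `(l, Dk) = 1`: `θ(l) = θ*(l)` and `(l, h) = 1`
    have hlh : Nat.Coprime l h := Nat.Coprime.coprime_dvd_right ⟨r, hhr.symm⟩ hl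
    rw [if_pos hlh]
    have hc : IsCoprime (l : ℤ) ((D * k : ℕ) : ℤ) := Nat.isCoprime_iff_coprime.mpr hl
    have e2 := DirichletCharacter.changeLevel_eq_cast_of_dvd' θ hr hc
    push_cast at e2
    rw [e2]
  · -- `(l, Dk) > 1`: `θ(l) = 0`, and the right side vanishes too
    have hz : DirichletCharacter.changeLevel hr θ (l : ZMod (D * k)) = 0 := by
      refine MulChar.map_nonunit _ ?_
      rwa [ZMod.isUnit_iff_coprime]
    rw [hz, mul_zero, zero_mul]
    split_ifs with hlh
    · have hlr : ¬ Nat.Coprime l r := fun hlr => hl (by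
        rw [← hhr]; exact Nat.Coprime.mul_right hlh hlr)
      have hz' : θ (l : ZMod r) = 0 := by
        refine MulChar.map_nonunit _ ?_
        rwa [ZMod.isUnit_iff_coprime]
      rw [hz', mul_zero, zero_mul]
    · rfl

/-! ## One conductor, with a weight -/

/-- **u017, one fiber, weighted**: for `r ∣ Dk`, the terms of the twisted left side of (14.8) (fixed
`d`, `k`) with `θ` of conductor exactly `r` are at most `√r` times the twisted u017 inner sum at
`(r, h = Dk/r)`; empty fiber for `r < 2`. Same proof as `fiber_sum_le`.
[cite: Zhang2022LandauSiegel, §14 u017 p.79, tex L3950–L3956] -/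
theorem fiber_sum_le_w {D : ℕ} [NeZero D] (χ : DirichletCharacter ℂ D) (hχ : χ.IsPrimitive)
    (w : ℕ → ℂ) {k r : ℕ} (hk : 0 < k) (hr : r ∣ D * k) (κs : ℕ → ℂ) (d : ℕ)
    (hcop : ∀ p ∈ primeWindow D, Nat.Coprime p (D * k)) :
    ∑ θ ∈ (finsetOf {θ : DirichletCharacter ℂ (D * k) | θ ≠ 1 ∧ θ ≠ thetaOne χ k}).filter
        (fun θ => θ.conductor = r),
      ‖tauSum (D * k) θ⁻¹‖ *
        ‖∑' l : ℕ, κs (d * l) * θ (l : ZMod (D * k)) *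
            ∑ p ∈ primeWindow D, χ (p : ZMod D) * θ⁻¹ (p : ZMod (D * k)) * w p *
              DeltaW D ((l : ℝ) / ((D : ℝ) * p * k))‖ ≤
      if 2 ≤ r then Real.sqrt r *
        ∑ θ ∈ finsetOf {θ : DirichletCharacter ℂ r | θ.IsPrimitive ∧
            DirichletCharacter.changeLevel (dvd_mul_left r D) θ ≠
              DirichletCharacter.changeLevel (dvd_mul_right D r) χ},
          ‖∑' l : ℕ, if Nat.Coprime l (D * k / r) then
              κs (d * l) * θ (l : ZMod r) *
                ∑ p ∈ primeWindow D, χ (p : ZMod D) * θ⁻¹ (p : ZMod r) * w p *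
                  DeltaW D ((l : ℝ) / ((p : ℝ) * ↑(D * k / r) * r)) else 0‖
      else 0 := by
  classical
  haveI hDk : NeZero (D * k) := ⟨Nat.mul_ne_zero (NeZero.ne D) hk.ne'⟩
  have hTfin : ({θ : DirichletCharacter ℂ (D * k) | θ ≠ 1 ∧ θ ≠ thetaOne χ k}).Finite :=
    Set.toFinite _
  split_ifs with h2
  · -- `2 ≤ r`
    haveI : NeZero r := ⟨by omega⟩
    have hSfin : ({θ : DirichletCharacter ℂ r | θ.IsPrimitive ∧
        DirichletCharacter.changeLevel (dvd_mul_left r D) θ ≠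
          DirichletCharacter.changeLevel (dvd_mul_right D r) χ}).Finite := Set.toFinite _
    have hhr : D * k / r * r = D * k := Nat.div_mul_cancel hr
    -- the fiber lies in the image of the primitive characters mod `r` under induction
    have hsub : (finsetOf {θ : DirichletCharacter ℂ (D * k) | θ ≠ 1 ∧ θ ≠ thetaOne χ k}).filter
          (fun θ => θ.conductor = r) ⊆
        (finsetOf {θ : DirichletCharacter ℂ r | θ.IsPrimitive ∧
            DirichletCharacter.changeLevel (dvd_mul_left r D) θ ≠
              DirichletCharacter.changeLevel (dvd_mul_right D r) χ}).image
          (DirichletCharacter.changeLevel hr) := by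
      intro θ hθ
      rw [Finset.mem_filter] at hθ
      obtain ⟨hθT, hcond⟩ := hθ
      obtain ⟨hne1, hneχ⟩ := (mem_finsetOf hTfin).mp hθT
      have hft : θ.FactorsThrough r :=
        (DirichletCharacter.mem_conductorSet_iff_conductor_dvd θ hr).mpr (hcond ▸ dvd_rfl)
      obtain ⟨θ₀, hθ₀⟩ : ∃ θ₀ : DirichletCharacter ℂ r,
          θ = DirichletCharacter.changeLevel hr θ₀ := ⟨hft.χ₀, hft.eq_changeLevel⟩
      refine Finset.mem_image.mpr ⟨θ₀, ?_, hθ₀.symm⟩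
      rw [mem_finsetOf hSfin]
      have hprimθ₀ : θ₀.IsPrimitive := by
        rw [DirichletCharacter.isPrimitive_def, ← DirichletCharacter.conductor_changeLevel θ₀ hr,
          ← hθ₀, hcond]
      refine ⟨hprimθ₀, fun heq => hneχ ?_⟩
      have hrD : r = D := by
        have h1 := congrArg DirichletCharacter.conductor heq
        rwa [DirichletCharacter.conductor_changeLevel θ₀, DirichletCharacter.conductor_changeLevel χ,
          hprimθ₀, hχ] at h1
      subst hrD
      have hθχ : θ₀ = χ := DirichletCharacter.changeLevel_injective _ heq
      rw [hθ₀, hθχ, thetaOne]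
    have hinj : Set.InjOn (DirichletCharacter.changeLevel (R := ℂ) hr)
        ↑(finsetOf {θ : DirichletCharacter ℂ r | θ.IsPrimitive ∧
            DirichletCharacter.changeLevel (dvd_mul_left r D) θ ≠
              DirichletCharacter.changeLevel (dvd_mul_right D r) χ}) :=
      fun _ _ _ _ h => DirichletCharacter.changeLevel_injective hr h
    refine le_trans (Finset.sum_le_sum_of_subset_of_nonneg hsub fun θ _ _ =>
      mul_nonneg (norm_nonneg _) (norm_nonneg _)) ?_
    rw [Finset.sum_image hinj, Finset.mul_sum]
    refine Finset.sum_le_sum fun θ₀ hθ₀ => ?_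
    obtain ⟨hprim, -⟩ := (mem_finsetOf hSfin).mp hθ₀
    -- `|τ(θ̄)| ≤ √r`
    have hτ : ‖tauSum (D * k) (DirichletCharacter.changeLevel hr θ₀)⁻¹‖ ≤ Real.sqrt r := by
      have h79 := (step14p79_holds (D * k) (DirichletCharacter.changeLevel hr θ₀) (NeZero.pos _)).2
      rwa [DirichletCharacter.conductor_changeLevel θ₀ hr, hprim] at h79
    -- the series agree termwise
    have hser : (∑' l : ℕ, κs (d * l) * DirichletCharacter.changeLevel hr θ₀ (l : ZMod (D * k)) *
          ∑ p ∈ primeWindow D, χ (p : ZMod D) *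
            (DirichletCharacter.changeLevel hr θ₀)⁻¹ (p : ZMod (D * k)) * w p *
              DeltaW D ((l : ℝ) / ((D : ℝ) * p * k))) =
        ∑' l : ℕ, if Nat.Coprime l (D * k / r) then
          κs (d * l) * θ₀ (l : ZMod r) *
            ∑ p ∈ primeWindow D, χ (p : ZMod D) * θ₀⁻¹ (p : ZMod r) * w p *
              DeltaW D ((l : ℝ) / ((p : ℝ) * ↑(D * k / r) * r)) else 0 :=
      tsum_congr fun l => changeLevel_term_eq_w χ w hhr hr θ₀ κs d l hcop
    rw [hser]
    exact mul_le_mul_of_nonneg_right hτ (norm_nonneg _)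
  · -- `r < 2`: the fiber is empty (`θ ≠ 1` has conductor `≥ 2`)
    have hempty : ∀ θ ∈ (finsetOf {θ : DirichletCharacter ℂ (D * k) | θ ≠ 1 ∧ θ ≠ thetaOne χ k}).filter
        (fun θ => θ.conductor = r), False := by
      intro θ hθ
      rw [Finset.mem_filter] at hθ
      obtain ⟨hθT, hcond⟩ := hθ
      obtain ⟨hne1, -⟩ := (mem_finsetOf hTfin).mp hθT
      have hc0 : θ.conductor ≠ 0 := DirichletCharacter.conductor_ne_zero θ
      have hc1 : θ.conductor ≠ 1 := fun h =>
        hne1 (DirichletCharacter.eq_one_iff_conductor_eq_one.mpr h)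
      omega
    rw [Finset.sum_eq_zero fun θ hθ => (hempty θ hθ).elim]

/-! ## One `k`, with a weight -/

/-- **u017 for one `k`, weighted**: the `k`-th term of the twisted left side of (14.8) (fixed `d`) is at
most `Σ_{r ∣ Dk, r ≥ 2} B·D/(φ(hr)h√r)·(twisted u017 inner sum at (r, h = Dk/r))`. Same proof as
`term_k_le`. [cite: Zhang2022LandauSiegel, §14 u017 p.79, tex L3950–L3956] -/
theorem term_k_le_w {D : ℕ} [NeZero D] (χ : DirichletCharacter ℂ D) (hχ : χ.IsPrimitive)
    (w : ℕ → ℂ) {B : ℝ} {as : ℕ → ℂ} (has : ∀ n, ‖as n‖ ≤ B) (κs : ℕ → ℂ) (d : ℕ) {k : ℕ} (hk : 0 < k)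
    (hcop : ∀ p ∈ primeWindow D, Nat.Coprime p (D * k)) :
    ‖as (d * k)‖ / ((Nat.totient (D * k) : ℝ) * k) *
        ∑ θ ∈ finsetOf {θ : DirichletCharacter ℂ (D * k) | θ ≠ 1 ∧ θ ≠ thetaOne χ k},
          ‖tauSum (D * k) θ⁻¹‖ *
            ‖∑' l : ℕ, κs (d * l) * θ (l : ZMod (D * k)) *
                ∑ p ∈ primeWindow D, χ (p : ZMod D) * θ⁻¹ (p : ZMod (D * k)) * w p *
                  DeltaW D ((l : ℝ) / ((D : ℝ) * p * k))‖ ≤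
      ∑ r ∈ (D * k).divisors, if 2 ≤ r then
        B * ((D : ℝ) / ((Nat.totient (D * k / r * r) : ℝ) * ↑(D * k / r) * Real.sqrt r) *
          ∑ θ ∈ finsetOf {θ : DirichletCharacter ℂ r | θ.IsPrimitive ∧
              DirichletCharacter.changeLevel (dvd_mul_left r D) θ ≠
                DirichletCharacter.changeLevel (dvd_mul_right D r) χ},
            ‖∑' l : ℕ, if Nat.Coprime l (D * k / r) then
                κs (d * l) * θ (l : ZMod r) *
                  ∑ p ∈ primeWindow D, χ (p : ZMod D) * θ⁻¹ (p : ZMod r) * w p *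
                    DeltaW D ((l : ℝ) / ((p : ℝ) * ↑(D * k / r) * r)) else 0‖) else 0 := by
  classical
  haveI hDk : NeZero (D * k) := ⟨Nat.mul_ne_zero (NeZero.ne D) hk.ne'⟩
  have hmaps : ∀ θ ∈ finsetOf {θ : DirichletCharacter ℂ (D * k) | θ ≠ 1 ∧ θ ≠ thetaOne χ k},
      θ.conductor ∈ (D * k).divisors := fun θ _ =>
    Nat.mem_divisors.mpr ⟨θ.conductor_dvd_level, NeZero.ne _⟩
  rw [← Finset.sum_fiberwise_of_maps_to hmaps, Finset.mul_sum]
  refine Finset.sum_le_sum fun r hr => ?_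
  have hrdvd : r ∣ D * k := (Nat.mem_divisors.mp hr).1
  have hfib := fiber_sum_le_w χ hχ w hk hrdvd κs d hcop
  have ha : 0 ≤ ‖as (d * k)‖ / ((Nat.totient (D * k) : ℝ) * k) := by positivity
  refine le_trans (mul_le_mul_of_nonneg_left hfib ha) ?_
  split_ifs with h2
  · have hr0 : 0 < r := by omega
    have hhr : D * k / r * r = D * k := Nat.div_mul_cancel hrdvd
    have hS : 0 ≤ ∑ θ ∈ finsetOf {θ : DirichletCharacter ℂ r | θ.IsPrimitive ∧
            DirichletCharacter.changeLevel (dvd_mul_left r D) θ ≠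
              DirichletCharacter.changeLevel (dvd_mul_right D r) χ},
          ‖∑' l : ℕ, if Nat.Coprime l (D * k / r) then
              κs (d * l) * θ (l : ZMod r) *
                ∑ p ∈ primeWindow D, χ (p : ZMod D) * θ⁻¹ (p : ZMod r) * w p *
                  DeltaW D ((l : ℝ) / ((p : ℝ) * ↑(D * k / r) * r)) else 0‖ :=
      Finset.sum_nonneg fun _ _ => norm_nonneg _
    have hφ : (0 : ℝ) < Nat.totient (D * k) := by exact_mod_cast Nat.totient_pos.mpr (NeZero.pos _)
    have hk' : (0 : ℝ) < k := by exact_mod_cast hk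
    have hr' : (0 : ℝ) < r := by exact_mod_cast hr0
    have hq : ((D * k / r : ℕ) : ℝ) * r = (D : ℝ) * k := by exact_mod_cast hhr
    have hqpos : (0 : ℝ) < (D * k / r : ℕ) := by
      exact_mod_cast Nat.div_pos (Nat.le_of_dvd (NeZero.pos _) hrdvd) hr0
    have hsq : Real.sqrt r * Real.sqrt r = r := Real.mul_self_sqrt (Nat.cast_nonneg r)
    have hsqpos : 0 < Real.sqrt r := Real.sqrt_pos.mpr hr'
    -- the weight identity `D/(φ(hr)h√r) = √r/(φ(Dk)k)` for `hr = Dk`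
    have hid : (D : ℝ) / ((Nat.totient (D * k / r * r) : ℝ) * ↑(D * k / r) * Real.sqrt r) =
        Real.sqrt r / ((Nat.totient (D * k) : ℝ) * k) := by
      rw [hhr, div_eq_div_iff (by positivity) (by positivity)]
      calc (D : ℝ) * ((Nat.totient (D * k) : ℝ) * k)
            = (Nat.totient (D * k) : ℝ) * ((D : ℝ) * k) := by ring
        _ = (Nat.totient (D * k) : ℝ) * (((D * k / r : ℕ) : ℝ) * r) := by rw [hq]
        _ = (Nat.totient (D * k) : ℝ) * ((D * k / r : ℕ) : ℝ) * (Real.sqrt r * Real.sqrt r) := by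
            rw [hsq]; ring
        _ = Real.sqrt r * ((Nat.totient (D * k) : ℝ) * ↑(D * k / r) * Real.sqrt r) := by ring
    have hkey : ‖as (d * k)‖ / ((Nat.totient (D * k) : ℝ) * k) * Real.sqrt r ≤
        B * ((D : ℝ) / ((Nat.totient (D * k / r * r) : ℝ) * ↑(D * k / r) * Real.sqrt r)) := by
      rw [hid]
      calc ‖as (d * k)‖ / ((Nat.totient (D * k) : ℝ) * k) * Real.sqrt r
            = ‖as (d * k)‖ * (Real.sqrt r / ((Nat.totient (D * k) : ℝ) * k)) := by ring
        _ ≤ B * (Real.sqrt r / ((Nat.totient (D * k) : ℝ) * k)) :=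
            mul_le_mul_of_nonneg_right (has _) (by positivity)
    calc ‖as (d * k)‖ / ((Nat.totient (D * k) : ℝ) * k) * (Real.sqrt r * _)
          = (‖as (d * k)‖ / ((Nat.totient (D * k) : ℝ) * k) * Real.sqrt r) * _ := by ring
      _ ≤ (B * ((D : ℝ) / ((Nat.totient (D * k / r * r) : ℝ) * ↑(D * k / r) * Real.sqrt r))) * _ :=
          mul_le_mul_of_nonneg_right hkey hS
      _ = _ := by ring
  · simp

/-! ## W-u017: the twisted re-indexing on the closed conductor range -/

/-- **§14 u017 at general `β`, kernel-checked on the closed conductor range** (Z22 p.79, tex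
L3950–L3956; p.76 "the general case is almost identical"): for every `B`, all large `D` (every real
primitive `χ (mod D)`), every `β : ℂ` and all `𝐤*, 𝐚*` under (14.1)–(14.2),
`lhs148W χ β 𝐤* 𝐚* ≤ B · rhs1417OnW χ β 𝐤* (Finset.Icc 2 ⌊2DP₄⌋₊)`. Neither Assumption (A) nor a
bound on `β` is used (the re-indexing never looks inside the `p`-sum).
[cite: Zhang2022LandauSiegel, §14 u017 p.79, tex L3950–L3956] -/
theorem lhs148W_le_rhs1417OnW_closed (B : ℝ) :
    ForAllLarge fun D _ χ => ∀ β : ℂ, ∀ κs as : ℕ → ℂ, Eq141 B κs → Eq142 D B as →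
      lhs148W χ β κs as ≤ B * rhs1417OnW χ β κs (Finset.Icc 2 ⌊2 * (D : ℝ) * P4 D⌋₊) := by
  classical
  obtain ⟨D₁, hD₁⟩ := exists_two_mul_D_mul_P4_lt_bigP
  refine ⟨D₁, fun D _ χ hD _ hprim β κs as _ h142 => ?_⟩
  have hB : 0 ≤ B := (norm_nonneg _).trans (h142.1 0)
  have hD0 : 0 < D := NeZero.pos D
  have hDP : 2 * (D : ℝ) * P4 D < bigP D := hD₁ D hD
  have hP4 : 0 ≤ P4 D := by
    rw [P4, t0]
    exact mul_nonneg (div_nonneg (Real.exp_pos _).le (pow_nonneg (Real.exp_pos _).le 2))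
      (pow_nonneg (Real.log_natCast_nonneg D) 519)
  -- `D⌊2P₄⌋ ≤ ⌊2DP₄⌋` and `D⌊2P₄⌋ < P`
  have hDK : ((D * ⌊2 * P4 D⌋₊ : ℕ) : ℝ) ≤ 2 * (D : ℝ) * P4 D := by
    push_cast
    have := Nat.floor_le (show 0 ≤ 2 * P4 D by linarith)
    nlinarith [Nat.cast_nonneg (α := ℝ) D]
  have hKM : D * ⌊2 * P4 D⌋₊ ≤ ⌊2 * (D : ℝ) * P4 D⌋₊ := Nat.le_floor hDK
  have hKP : ((D * ⌊2 * P4 D⌋₊ : ℕ) : ℝ) < bigP D := hDK.trans_lt hDP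
  -- every `p ∼ P` is prime to `Dk` for `k ≤ 2P₄` (`p > P > 2DP₄ ≥ Dk`)
  have hcop : ∀ k ∈ Finset.Icc 1 ⌊2 * P4 D⌋₊, ∀ p ∈ primeWindow D, Nat.Coprime p (D * k) := by
    intro k hk p hp
    have hprime : p.Prime := (Finset.mem_filter.mp hp).2
    have hPp : bigP D < p :=
      (Nat.floor_lt (Real.exp_pos _).le).mp (Finset.mem_Ioo.mp (Finset.mem_filter.mp hp).1).1
    obtain ⟨hk1, hk2⟩ := Finset.mem_Icc.mp hk
    have hDk : D * k < p := by
      have h1 : ((D * k : ℕ) : ℝ) ≤ ((D * ⌊2 * P4 D⌋₊ : ℕ) : ℝ) := by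
        exact_mod_cast Nat.mul_le_mul_left D hk2
      exact_mod_cast (h1.trans_lt hKP).trans hPp
    have hDk0 : 0 < D * k := Nat.mul_pos hD0 hk1
    exact (Nat.Prime.coprime_iff_not_dvd hprime).mpr fun h =>
      absurd (Nat.le_of_dvd hDk0 h) (not_le.mpr hDk)
  unfold lhs148W rhs1417OnW
  rw [Finset.mul_sum]
  refine Finset.sum_le_sum fun d _ => ?_
  rw [mul_left_comm]
  refine mul_le_mul_of_nonneg_left ?_ (inv_nonneg.mpr (Nat.cast_nonneg d))
  -- for this `d`: bound each `k`-term by the conductor split, then re-index `(k, r) ↦ (r, Dk/r)`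
  refine le_trans (Finset.sum_le_sum fun k hk =>
    term_k_le_w χ hprim (wt D β) h142.1 κs d (Finset.mem_Icc.mp hk).1 (hcop k hk)) ?_
  -- the u017 summand as a function of `(r, h)`
  set g : ℕ → ℕ → ℝ := fun r h => (D : ℝ) / ((Nat.totient (h * r) : ℝ) * h * Real.sqrt r) *
      ∑ θ ∈ finsetOf {θ : DirichletCharacter ℂ r | θ.IsPrimitive ∧
          DirichletCharacter.changeLevel (dvd_mul_left r D) θ ≠
            DirichletCharacter.changeLevel (dvd_mul_right D r) χ},
        ‖∑' l : ℕ, if Nat.Coprime l h then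
            κs (d * l) * θ (l : ZMod r) *
              ∑ p ∈ primeWindow D, χ (p : ZMod D) * θ⁻¹ (p : ZMod r) * wt D β p *
                DeltaW D ((l : ℝ) / ((p : ℝ) * h * r)) else 0‖ with hg_def
  have hg_nonneg : ∀ r h, 0 ≤ g r h := fun r h =>
    mul_nonneg (div_nonneg (Nat.cast_nonneg D)
      (mul_nonneg (mul_nonneg (Nat.cast_nonneg _) (Nat.cast_nonneg h)) (Real.sqrt_nonneg r)))
      (Finset.sum_nonneg fun _ _ => norm_nonneg _)
  have hpull : ∀ k ∈ Finset.Icc 1 ⌊2 * P4 D⌋₊,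
      (∑ r ∈ (D * k).divisors, if 2 ≤ r then
        B * ((D : ℝ) / ((Nat.totient (D * k / r * r) : ℝ) * ↑(D * k / r) * Real.sqrt r) *
          ∑ θ ∈ finsetOf {θ : DirichletCharacter ℂ r | θ.IsPrimitive ∧
              DirichletCharacter.changeLevel (dvd_mul_left r D) θ ≠
                DirichletCharacter.changeLevel (dvd_mul_right D r) χ},
            ‖∑' l : ℕ, if Nat.Coprime l (D * k / r) then
                κs (d * l) * θ (l : ZMod r) *
                  ∑ p ∈ primeWindow D, χ (p : ZMod D) * θ⁻¹ (p : ZMod r) * wt D β p *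
                    DeltaW D ((l : ℝ) / ((p : ℝ) * ↑(D * k / r) * r)) else 0‖) else 0) =
      B * ∑ r ∈ (D * k).divisors, if 2 ≤ r then g r (D * k / r) else 0 := by
    intro k _
    rw [Finset.mul_sum]
    refine Finset.sum_congr rfl fun r _ => ?_
    split_ifs
    · simp only [hg_def]
    · simp
  rw [Finset.sum_congr rfl hpull, ← Finset.mul_sum]
  refine mul_le_mul_of_nonneg_left ?_ hB
  have hfin := sum_divisors_reindex_le D ⌊2 * P4 D⌋₊ ⌊2 * (D : ℝ) * P4 D⌋₊ (bigP D) hD0 hKM hKP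
    g hg_nonneg
  calc _ ≤ _ := hfin
    _ = _ := by simp only [hg_def]

/-- **W-u017 as asked** (HOME/strike/zl-closer-5/WANTED.md §2): for every `B` there is `C` (namely
`C = B`) with `lhs148W χ β 𝐤* 𝐚* ≤ C · rhs1417OnW χ β 𝐤* [2, ⌊2DP₄⌋]` for all large `D` under (A), every
`β : ℂ`, and all `𝐤*, 𝐚*` under (14.1)–(14.2). [cite: Zhang2022LandauSiegel, §14 u017 p.79, tex L3956] -/
theorem step14u017W_closed : ∀ B : ℝ, ∃ C : ℝ, ForAllLarge fun D _ χ => AssumptionA D χ →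
    ∀ β : ℂ, ∀ κs as : ℕ → ℂ, Eq141 B κs → Eq142 D B as →
      lhs148W χ β κs as ≤ C * rhs1417OnW χ β κs (Finset.Icc 2 ⌊2 * (D : ℝ) * P4 D⌋₊) := by
  intro B
  obtain ⟨D₀, h⟩ := lhs148W_le_rhs1417OnW_closed B
  exact ⟨B, D₀, fun D _ χ hD hq hp _ β κs as h141 h142 => h D χ hD hq hp β κs as h141 h142⟩

/-! ## (14.8)ᵂ from the two `r`-ranges -/

/-- The twisted u017 majorant splits over any partition of the `r`-range by a predicate.
[cite: Zhang2022LandauSiegel, §14 u017 p.79, tex L3960] -/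
theorem rhs1417OnW_filter_add {D : ℕ} (χ : DirichletCharacter ℂ D) (β : ℂ) (κs : ℕ → ℂ)
    (S : Finset ℕ) (q : ℕ → Prop) [DecidablePred q] :
    rhs1417OnW χ β κs S =
      rhs1417OnW χ β κs (S.filter q) + rhs1417OnW χ β κs (S.filter fun r => ¬ q r) := by
  rw [rhs1417OnW, rhs1417OnW, rhs1417OnW, ← Finset.sum_add_distrib]
  refine Finset.sum_congr rfl fun d _ => ?_
  rw [← mul_add, Finset.sum_filter_add_sum_filter_not]

/-- **(14.8)ᵂ ⇐ W-u017 + the two `r`-range estimates (W-leg1, W-leg2), closed range** — the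
general-`β` twin of `Typed.Sec14.eq148_of_legs`: from "for `1 < r < D³` … Lemma 5.4 (i) and Lemma 5.6"
and "for `D³ ≤ r < 2DP₄` … the large sieve inequality" (p. 79), each with the twist `(pt₀)^β` inside the
`p`-sum and on the closed range `r ≤ 2DP₄` (stated inline, exactly the W-leg1/W-leg2 shapes), the twisted
(14.8) `lhs148W χ β 𝐤* 𝐚* ≤ C·P²·D^{−c}` for `|β| < 5α` — word for word the hypothesis `h148` of
`Typed.Sec14.eq145W_of_parts`; `c = min(c₁,c₂)`, `C = |B|(|C₁| + |C₂|)`.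
[cite: Zhang2022LandauSiegel, §14 (14.8) (proof) p.79, tex L3956–L3963] -/
theorem eq148W_of_legs_closed
    (h1 : ∀ B : ℝ, ∃ c : ℝ, 0 < c ∧ ∃ C : ℝ, ForAllLarge fun D _ χ => AssumptionA D χ →
      ∀ β : ℂ, ‖β‖ < 5 * alpha D → ∀ κs as : ℕ → ℂ, Eq141 B κs → Eq142 D B as →
        rhs1417OnW χ β κs ((Finset.Icc 2 ⌊2 * (D : ℝ) * P4 D⌋₊).filter (fun r => r < D ^ 3))
          ≤ C * bigP D ^ 2 * (D : ℝ) ^ (-c))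
    (h2 : ∀ B : ℝ, ∃ c : ℝ, 0 < c ∧ ∃ C : ℝ, ForAllLarge fun D _ χ => AssumptionA D χ →
      ∀ β : ℂ, ‖β‖ < 5 * alpha D → ∀ κs as : ℕ → ℂ, Eq141 B κs → Eq142 D B as →
        rhs1417OnW χ β κs ((Finset.Icc 2 ⌊2 * (D : ℝ) * P4 D⌋₊).filter (fun r => ¬ r < D ^ 3))
          ≤ C * bigP D ^ 2 * (D : ℝ) ^ (-c)) :
    ∀ B : ℝ, ∃ c : ℝ, 0 < c ∧ ∃ C : ℝ, ForAllLarge fun D _ χ => AssumptionA D χ →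
      ∀ β : ℂ, ‖β‖ < 5 * alpha D → ∀ κs as : ℕ → ℂ, Eq141 B κs → Eq142 D B as →
        lhs148W χ β κs as ≤ C * bigP D ^ 2 * (D : ℝ) ^ (-c) := by
  intro B
  obtain ⟨c₁, hc₁, C₁, h1⟩ := h1 B
  obtain ⟨c₂, hc₂, C₂, h2⟩ := h2 B
  have h0 := lhs148W_le_rhs1417OnW_closed B
  refine ⟨min c₁ c₂, lt_min hc₁ hc₂, |B| * (|C₁| + |C₂|), ?_⟩
  obtain ⟨D₀, hD₀⟩ := (h0.and h1).and h2
  refine ⟨max D₀ 1, fun D _ χ hD hq hp hA β hβ κs as hκ ha => ?_⟩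
  have hD₀' : D₀ ≤ D := le_trans (le_max_left _ _) hD
  have hD1 : (1 : ℝ) ≤ D := by exact_mod_cast le_trans (le_max_right _ _) hD
  obtain ⟨⟨e0, e1⟩, e2⟩ := hD₀ D χ hD₀' hq hp
  have g0 := e0 β κs as hκ ha
  have g1 := e1 hA β hβ κs as hκ ha
  have g2 := e2 hA β hβ κs as hκ ha
  set M := ⌊2 * (D : ℝ) * P4 D⌋₊ with hM
  have hsplit := rhs1417OnW_filter_add χ β κs (Finset.Icc 2 M) (fun r => r < D ^ 3)
  set L₁ := rhs1417OnW χ β κs ((Finset.Icc 2 M).filter (fun r => r < D ^ 3))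
  set L₂ := rhs1417OnW χ β κs ((Finset.Icc 2 M).filter (fun r => ¬ r < D ^ 3))
  have hL₁ : 0 ≤ L₁ := rhs1417OnW_nonneg χ β κs _
  have hL₂ : 0 ≤ L₂ := rhs1417OnW_nonneg χ β κs _
  have hP : 0 ≤ bigP D ^ 2 := sq_nonneg _
  have hpow₁ : (D : ℝ) ^ (-c₁) ≤ (D : ℝ) ^ (-min c₁ c₂) :=
    Real.rpow_le_rpow_of_exponent_le hD1 (neg_le_neg (min_le_left c₁ c₂))
  have hpow₂ : (D : ℝ) ^ (-c₂) ≤ (D : ℝ) ^ (-min c₁ c₂) :=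
    Real.rpow_le_rpow_of_exponent_le hD1 (neg_le_neg (min_le_right c₁ c₂))
  have k1 : L₁ ≤ |C₁| * bigP D ^ 2 * (D : ℝ) ^ (-min c₁ c₂) :=
    calc L₁ ≤ C₁ * bigP D ^ 2 * (D : ℝ) ^ (-c₁) := g1
      _ ≤ |C₁| * bigP D ^ 2 * (D : ℝ) ^ (-c₁) := by
          gcongr
          exact le_abs_self C₁
      _ ≤ |C₁| * bigP D ^ 2 * (D : ℝ) ^ (-min c₁ c₂) := by gcongr
  have k2 : L₂ ≤ |C₂| * bigP D ^ 2 * (D : ℝ) ^ (-min c₁ c₂) :=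
    calc L₂ ≤ C₂ * bigP D ^ 2 * (D : ℝ) ^ (-c₂) := g2
      _ ≤ |C₂| * bigP D ^ 2 * (D : ℝ) ^ (-c₂) := by
          gcongr
          exact le_abs_self C₂
      _ ≤ |C₂| * bigP D ^ 2 * (D : ℝ) ^ (-min c₁ c₂) := by gcongr
  calc lhs148W χ β κs as ≤ B * rhs1417OnW χ β κs (Finset.Icc 2 M) := g0
    _ = B * (L₁ + L₂) := by rw [hsplit]
    _ ≤ |B| * (L₁ + L₂) := mul_le_mul_of_nonneg_right (le_abs_self B) (add_nonneg hL₁ hL₂)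
    _ ≤ |B| * (|C₁| * bigP D ^ 2 * (D : ℝ) ^ (-min c₁ c₂) +
          |C₂| * bigP D ^ 2 * (D : ℝ) ^ (-min c₁ c₂)) :=
        mul_le_mul_of_nonneg_left (add_le_add k1 k2) (abs_nonneg B)
    _ = |B| * (|C₁| + |C₂|) * bigP D ^ 2 * (D : ℝ) ^ (-min c₁ c₂) := by ring

end Literature.NumberTheory.LFunctions.Zhang2022.Typed.Sec14
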